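import Literature.Analysis.OperatorTheory.StandardSubspace
import Literature.Analysis.OperatorTheory.BorelFunctionalCalculus
import Mathlib.MeasureTheory.Measure.HasOuterApproxClosed
import Mathlib.MeasureTheory.Function.SpecialFunctions.Basic
import HarnessLib

/-!
# The modular unitary group `Δ^{it} = (2 − R)^{it} R^{−it}` of a standard real subspace
# (Rieffel–van Daele, §3: Definition 3.2, Proposition 3.3)

For a standard real subspace `K` of a complex Hilbert space (`K ∩ iK = 0`, `K + iK` dense) with
its operators `R = P + Q`, `T`, `J` (`Literature.Analysis.OperatorTheory.StandardSubspace`),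
Rieffel–van Daele (*A bounded operator approach to Tomita–Takesaki theory*, Pacific J. Math. 69
(1977), §3) define the modular group without ever forming the unbounded `Δ = (2 − R)R⁻¹`:

> DEFINITION 3.2. For each real `t` let `Δ^{it} = (2 − R)^{it} R^{−it}`, so that `{Δ^{it}}` is a
> one-parameter unitary group.
> PROPOSITION 3.3. For any real `t`, `J Δ^{it} = Δ^{it} J` and `Δ^{it} 𝒦 = 𝒦`.

("by spectral theory we can define `R^{it}` and `(2 − R)^{it}` … two commuting one-parameter
unitary groups which are strongly continuous … From the fact that `JRJ = 2 − R` it follows easily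
that `J R^{it} J = (2 − R)^{−it}`", p. 194.) Here `Δ^{it}` is `f_t(R)` for the bounded Borel
function `f_t(λ) = exp(it(log(2 − λ) − log λ))` (unimodular, `f_s f_t = f_{s+t}`), through the
Borel functional calculus `borelCFC` of `Literature.Analysis.OperatorTheory.BorelFunctionalCalculus`;
the values of `f_t` at the endpoints `0, 2` (not eigenvalues) are irrelevant but fixed so that all
identities hold pointwise.

## Main definitions and results

* `modPhase t` — the functions `f_t`; `modU K t` — the modular unitaries `Δ^{it}`.
* `modU_mem_unitary`, `modU_zero`, `modU_add`, `star_modU`, `continuous_modU_apply` — a strongly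
  continuous one-parameter unitary group (Def. 3.2).
* `modU_apply_of_modR_apply_eq` — vectors with `R ψ = ψ` are fixed (used for `Δ^{it} Ω = Ω`).
* `specMeasure_modJ`, `modJ_borelCFC` — `J f(R) J = f̄(2 − R)` for bounded Borel `f`;
  `modJ_modU` — **`J Δ^{it} = Δ^{it} J`** (Prop. 3.3); `modU_modB`, `modU_starProjection`,
  `modU_starProjection_mulI` — `Δ^{it}` commutes with `P − Q`, `P`, `Q`, hence **`Δ^{it} 𝒦 = 𝒦`**
  (Prop. 3.3).

## References
* M. A. Rieffel, A. van Daele, *A bounded operator approach to Tomita–Takesaki theory*, Pacific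
  J. Math. 69 (1977) 187–221, Def. 3.2, Prop. 3.3. [RieffelVandaele1977]
-/

noncomputable section

open Complex ContinuousLinearMap MeasureTheory Filter
open _root_.Topology
open scoped InnerProductSpace ComplexConjugate

set_option synthInstance.maxHeartbeats 200000

namespace Literature.Analysis.OperatorTheory

attribute [local instance] realIPS

variable {H : Type*} [NormedAddCommGroup H] [InnerProductSpace ℂ H] [CompleteSpace H]

/-! ### The phase functions `f_t(λ) = exp(it(log(2 − λ) − log λ))` -/

/-- The phase function `f_t(λ) = ((2 − λ)/λ)^{it} = exp(it(log(2−λ) − log λ))` (Rieffel–van Daele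
Def. 3.2, `Δ^{it} = (2−R)^{it} R^{−it}`), extended to all of `ℝ` by Mathlib's conventions for
`Real.log`. [cite: RieffelVandaele1977, Def. 3.2] -/
def modPhase (t : ℝ) (l : ℝ) : ℂ :=
  Complex.exp (((t * (Real.log (2 - l) - Real.log l) : ℝ) : ℂ) * I)

/-- Unfolding `modPhase`. [cite: RieffelVandaele1977, Def. 3.2] -/
theorem modPhase_apply (t l : ℝ) :
    modPhase t l = Complex.exp (((t * (Real.log (2 - l) - Real.log l) : ℝ) : ℂ) * I) := rfl

/-- `f_t` is Borel measurable. [folklore] -/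
theorem measurable_modPhase (t : ℝ) : Measurable (modPhase t) := by
  unfold modPhase
  refine Complex.measurable_exp.comp ?_
  refine (Complex.measurable_ofReal.comp ?_).mul_const _
  exact (((Real.measurable_log.comp (measurable_const.sub measurable_id)).sub
    Real.measurable_log).const_mul t)

/-- `|f_t| = 1`. [cite: RieffelVandaele1977, Def. 3.2] -/
theorem norm_modPhase (t l : ℝ) : ‖modPhase t l‖ = 1 := by
  rw [modPhase_apply, Complex.norm_exp_ofReal_mul_I]

/-- `|f_t| ≤ 1`. [cite: RieffelVandaele1977, Def. 3.2] -/
theorem norm_modPhase_le (t l : ℝ) : ‖modPhase t l‖ ≤ 1 := (norm_modPhase t l).le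

/-- `t ↦ f_t(λ)` is continuous. [folklore] -/
theorem continuous_modPhase_left (l : ℝ) : Continuous fun t => modPhase t l := by
  unfold modPhase; fun_prop

/-- `f_0 = 1`. [cite: RieffelVandaele1977, Def. 3.2] -/
theorem modPhase_zero : modPhase 0 = fun _ => (1 : ℂ) := by
  ext l; simp [modPhase_apply]

/-- **Group law** `f_{s+t} = f_s f_t`. [cite: RieffelVandaele1977, Def. 3.2] -/
theorem modPhase_add (s t : ℝ) : modPhase (s + t) = modPhase s * modPhase t := by
  ext l
  simp only [Pi.mul_apply, modPhase_apply, ← Complex.exp_add]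
  congr 1
  push_cast
  ring

/-- `f̄_t = f_{−t}`. [cite: RieffelVandaele1977, Def. 3.2] -/
theorem star_modPhase (t : ℝ) : star (modPhase t) = modPhase (-t) := by
  ext l
  simp only [Pi.star_apply, modPhase_apply, Complex.star_def, ← Complex.exp_conj, map_mul,
    Complex.conj_ofReal, Complex.conj_I]
  congr 1
  push_cast
  ring

/-- **Reflection symmetry** `conj (f_t(2 − λ)) = f_t(λ)` (the relation behind
`J Δ^{it} J = Δ^{it}`). [cite: RieffelVandaele1977, Prop. 3.3] -/
theorem conj_modPhase_two_sub (t l : ℝ) : conj (modPhase t (2 - l)) = modPhase t l := by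
  simp only [modPhase_apply, ← Complex.exp_conj, map_mul, Complex.conj_ofReal, Complex.conj_I,
    sub_sub_cancel]
  congr 1
  push_cast
  ring

/-- `f_t(1) = 1`. [cite: RieffelVandaele1977, Def. 3.2] -/
theorem modPhase_one (t : ℝ) : modPhase t 1 = 1 := by
  simp [modPhase_apply, show (2 : ℝ) - 1 = 1 by norm_num]

/-! ### The modular unitary group -/

section ModU

variable (K : Submodule ℝ H) [K.HasOrthogonalProjection]

/-- **The modular unitaries** `Δ^{it} = (2 − R)^{it} R^{−it} = f_t(R)` of the standard subspace `K`
(Rieffel–van Daele Def. 3.2), via the Borel functional calculus of `R`. [cite: RieffelVandaele1977, Def. 3.2] -/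
def modU (t : ℝ) : H →L[ℂ] H :=
  borelCFC (modR K) (modR_isSelfAdjoint K) (modPhase t)

/-- Unfolding `modU`. [cite: RieffelVandaele1977, Def. 3.2] -/
theorem modU_def (t : ℝ) : modU K t = borelCFC (modR K) (modR_isSelfAdjoint K) (modPhase t) := rfl

/-- **`Δ^{it}` is unitary.** [cite: RieffelVandaele1977, Def. 3.2] -/
theorem modU_mem_unitary (t : ℝ) : modU K t ∈ unitary (H →L[ℂ] H) :=
  borelCFC_mem_unitary _ (measurable_modPhase t) (norm_modPhase t)

/-- **`Δ^{i0} = 1`.** [cite: RieffelVandaele1977, Def. 3.2] -/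
theorem modU_zero : modU K 0 = 1 := by
  rw [modU_def, modPhase_zero, borelCFC_one]

/-- **Group law** `Δ^{i(s+t)} = Δ^{is} Δ^{it}`. [cite: RieffelVandaele1977, Def. 3.2] -/
theorem modU_add (s t : ℝ) : modU K (s + t) = modU K s * modU K t := by
  rw [modU_def, modPhase_add, borelCFC_mul _ (measurable_modPhase s) (measurable_modPhase t)
    (norm_modPhase_le s) (norm_modPhase_le t), ← modU_def, ← modU_def]

/-- The modular unitaries commute among themselves. [cite: RieffelVandaele1977, Def. 3.2] -/
theorem modU_comm (s t : ℝ) : modU K s * modU K t = modU K t * modU K s := by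
  rw [← modU_add, ← modU_add, add_comm]

/-- **Adjoints** `(Δ^{it})* = Δ^{−it}`. [cite: RieffelVandaele1977, Def. 3.2] -/
theorem star_modU (t : ℝ) : star (modU K t) = modU K (-t) := by
  rw [modU_def, star_borelCFC _ (measurable_modPhase t) (norm_modPhase_le t), star_modPhase, ← modU_def]

/-- `Δ^{−it} Δ^{it} = 1`. [cite: RieffelVandaele1977, Def. 3.2] -/
theorem modU_neg_mul_self (t : ℝ) : modU K (-t) * modU K t = 1 := by
  rw [← modU_add, neg_add_cancel, modU_zero]

/-- `Δ^{it} Δ^{−it} = 1`. [cite: RieffelVandaele1977, Def. 3.2] -/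
theorem modU_mul_neg_self (t : ℝ) : modU K t * modU K (-t) = 1 := by
  rw [← modU_add, add_neg_cancel, modU_zero]

/-- `Δ^{it}` is an isometry. [cite: RieffelVandaele1977, Def. 3.2] -/
theorem norm_modU_apply (t : ℝ) (ψ : H) : ‖modU K t ψ‖ = ‖ψ‖ :=
  (modU K t).norm_map_of_mem_unitary (modU_mem_unitary K t) ψ

/-- **Strong continuity** of `t ↦ Δ^{it} ψ` (dominated convergence in the spectral measure of `ψ`).
[cite: RieffelVandaele1977, §3 (p. 194), Lemma 3.6] -/
theorem continuous_modU_apply (ψ : H) : Continuous fun t => modU K t ψ := by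
  rw [continuous_iff_seqContinuous]
  intro u t hut
  exact tendsto_borelCFC_apply_of_tendsto (modR_isSelfAdjoint K) (fun n => measurable_modPhase (u n))
    (measurable_modPhase t) (fun n l => norm_modPhase_le (u n) l) (norm_modPhase_le t)
    (fun l => ((continuous_modPhase_left l).tendsto t).comp hut) ψ

/-- `Δ^{it}` commutes with `R`. [cite: RieffelVandaele1977, Prop. 3.3 (proof)] -/
theorem modR_commute_modU (t : ℝ) : Commute (modR K) (modU K t) :=
  commute_borelCFC_self _ (measurable_modPhase t) (norm_modPhase_le t)

/-- `Δ^{it}` commutes with `T`. [cite: RieffelVandaele1977, Prop. 3.3 (proof)] -/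
theorem modT_commute_modU (t : ℝ) : Commute (modT K) (modU K t) :=
  commute_borelCFC _ (modR_commute_modT K).symm (measurable_modPhase t) (norm_modPhase_le t)

/-- **Fixed vectors**: if `R ψ = ψ` then `Δ^{it} ψ = ψ` (`f_t(1) = 1`; used for `Δ^{it} Ω = Ω`,
Rieffel–van Daele proof of Lemma 4.9: "`Rω = ω`"). [cite: RieffelVandaele1977, Lemma 4.9 (proof) and Thm. 4.10 (proof)] -/
theorem modU_apply_of_modR_apply_eq {ψ : H} (hψ : modR K ψ = ψ) (t : ℝ) : modU K t ψ = ψ := by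
  have h : modR K ψ = ((1 : ℝ) : ℂ) • ψ := by rw [hψ]; simp
  rw [modU_def, borelCFC_apply_of_apply_eq_smul _ h (measurable_modPhase t) (norm_modPhase_le t),
    modPhase_one, one_smul]

end ModU

/-! ### `J` and the functional calculus of `R`; `J Δ^{it} = Δ^{it} J` -/

section JU

variable (K : Submodule ℝ H) [K.HasOrthogonalProjection]
variable (hsep : ∀ x, x ∈ K → x ∈ mulI K → x = 0)
variable (hdense : Dense ((K ⊔ mulI K : Submodule ℝ H) : Set H))

/-- `cfc (2 − ·) R = 2 − R`. [folklore] -/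
theorem cfc_two_sub_modR : cfc (fun l : ℝ => 2 - l) (modR K) = 2 - modR K := by
  rw [cfc_sub _ _ (modR K), cfc_const (2 : ℝ) (modR K) (modR_isSelfAdjoint K),
    cfc_id' ℝ (modR K) (modR_isSelfAdjoint K), map_ofNat]

/-- `u(2 − R) = (u ∘ (2 − ·))(R)` for continuous `u`. [folklore] -/
theorem cfc_comp_two_sub {u : ℝ → ℝ} (hu : Continuous u) :
    cfc u (2 - modR K) = cfc (fun l => u (2 - l)) (modR K) := by
  rw [← cfc_two_sub_modR, ← cfc_comp' u (fun l : ℝ => 2 - l) (modR K) hu.continuousOn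
    (by fun_prop) (modR_isSelfAdjoint K)]

include hsep hdense in
/-- `J u(R) x = u(2 − R) J x = (u ∘ (2 − ·))(R) J x` for real continuous `u`.
[cite: RieffelVandaele1977, §3 (p. 194)] -/
theorem modJ_cfc_modR' {u : ℝ → ℝ} (hu : Continuous u) (x : H) :
    modJ K hsep hdense (cfc u (modR K) x) = cfc (fun l => u (2 - l)) (modR K) (modJ K hsep hdense x) := by
  rw [modJ_cfc_modR K hsep hdense hu, cfc_comp_two_sub K hu]

include hsep hdense in
/-- `u(R) J x = J (u ∘ (2 − ·))(R) x` for real continuous `u`. [cite: RieffelVandaele1977, §3 (p. 194)] -/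
theorem cfc_modR_modJ {u : ℝ → ℝ} (hu : Continuous u) (x : H) :
    cfc u (modR K) (modJ K hsep hdense x) = modJ K hsep hdense (cfc (fun l => u (2 - l)) (modR K) x) := by
  have h := modJ_cfc_modR' K hsep hdense (u := fun l => u (2 - l)) (by fun_prop) x
  rw [h]
  congr 1
  exact cfc_congr fun l _ => by rw [sub_sub_cancel]

/-- **`J g(R) = (ḡ ∘ (2 − ·))(R) J`** for continuous complex-valued `g` (Rieffel–van Daele §3:
"where the minus sign in the exponent of `(2 − R)` is caused by the conjugate linearity of `J`").
[cite: RieffelVandaele1977, §3 (p. 194)] -/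
theorem modJ_cfcC {g : ℝ → ℂ} (hg : Continuous g) (x : H) :
    modJ K hsep hdense (cfcC (modR K) g x) =
      cfcC (modR K) (fun l => conj (g (2 - l))) (modJ K hsep hdense x) := by
  have hR := modR_isSelfAdjoint K
  have hg' : Continuous fun l => conj (g (2 - l)) := Complex.continuous_conj.comp (by fun_prop)
  have e1 : modJ K hsep hdense (cfc (fun t => (g t).re) (modR K) x) =
      cfc (fun l => (g (2 - l)).re) (modR K) (modJ K hsep hdense x) :=
    modJ_cfc_modR' K hsep hdense (u := fun t => (g t).re) (by fun_prop) x
  have e2 : modJ K hsep hdense (cfc (fun t => (g t).im) (modR K) x) =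
      cfc (fun l => (g (2 - l)).im) (modR K) (modJ K hsep hdense x) :=
    modJ_cfc_modR' K hsep hdense (u := fun t => (g t).im) (by fun_prop) x
  have hX : cfc (fun t => (conj (g (2 - t)) : ℂ).re) (modR K) = cfc (fun l => (g (2 - l)).re) (modR K) :=
    cfc_congr fun l _ => by simp
  have hY : cfc (fun t => (conj (g (2 - t)) : ℂ).im) (modR K) =
      -cfc (fun l => (g (2 - l)).im) (modR K) := by
    rw [← cfc_neg]
    exact cfc_congr fun l _ => by simp
  rw [cfcC_eq_re_add_im hR hg, cfcC_eq_re_add_im hR hg', add_apply, add_apply, map_add,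
    smul_apply, smul_apply, LinearIsometryEquiv.map_smulₛₗ, e1, e2, hX, hY, Complex.conj_I,
    neg_apply, smul_neg, neg_smul]

/-- **The spectral measure of `J ψ` is the reflection of that of `ψ`** under `λ ↦ 2 − λ`
(from `J R J = 2 − R`). [cite: RieffelVandaele1977, Prop. 2.2 (5)] -/
theorem specMeasure_modJ (ψ : H) :
    specMeasure (modR K) (modR_isSelfAdjoint K) (modJ K hsep hdense ψ) =
      (specMeasure (modR K) (modR_isSelfAdjoint K) ψ).map (fun l : ℝ => 2 - l) := by
  have hR := modR_isSelfAdjoint K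
  haveI : IsFiniteMeasure ((specMeasure (modR K) hR ψ).map (fun l : ℝ => 2 - l)) :=
    Measure.isFiniteMeasure_map _ _
  refine ext_of_forall_integral_eq_of_IsFiniteMeasure fun u => ?_
  have hu : Continuous (u : ℝ → ℝ) := u.continuous
  -- both sides as complex numbers
  have h1 : ((∫ l, u l ∂(specMeasure (modR K) hR (modJ K hsep hdense ψ)) : ℝ) : ℂ) =
      ⟪modJ K hsep hdense ψ, cfc (u : ℝ → ℝ) (modR K) (modJ K hsep hdense ψ)⟫_ℂ :=
    (inner_cfc_eq_integral_specMeasure (modR K) hR _ u hu.continuousOn).symm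
  have h2 : ⟪modJ K hsep hdense ψ, cfc (u : ℝ → ℝ) (modR K) (modJ K hsep hdense ψ)⟫_ℂ =
      ⟪cfc (fun l => u (2 - l)) (modR K) ψ, ψ⟫_ℂ := by
    rw [cfc_modR_modJ K hsep hdense hu, inner_modJ_modJ]
  have h3 : ⟪cfc (fun l => u (2 - l)) (modR K) ψ, ψ⟫_ℂ =
      ((∫ l, u (2 - l) ∂(specMeasure (modR K) hR ψ) : ℝ) : ℂ) := by
    rw [← inner_conj_symm, inner_cfc_eq_integral_specMeasure (modR K) hR ψ _ (by fun_prop),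
      Complex.conj_ofReal]
  have h4 : ∫ l, u (2 - l) ∂(specMeasure (modR K) hR ψ) =
      ∫ l, u l ∂((specMeasure (modR K) hR ψ).map (fun l : ℝ => 2 - l)) := by
    rw [integral_map (by fun_prop) hu.aestronglyMeasurable]
  have := h1.trans (h2.trans h3)
  rw [h4] at this
  exact_mod_cast this

/-- **`J f(R) = (f̄ ∘ (2 − ·))(R) J` for bounded Borel `f`** (the Borel extension of
`J R^{it} J = (2 − R)^{−it}`). [cite: RieffelVandaele1977, §3 (p. 194)] -/
theorem modJ_borelCFC {f : ℝ → ℂ} (hf : Measurable f) {C : ℝ} (hC : ∀ l, ‖f l‖ ≤ C) (x : H) :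
    modJ K hsep hdense (borelCFC (modR K) (modR_isSelfAdjoint K) f x) =
      borelCFC (modR K) (modR_isSelfAdjoint K) (fun l => conj (f (2 - l))) (modJ K hsep hdense x) := by
  have hR := modR_isSelfAdjoint K
  have hrefl : Measurable fun l : ℝ => 2 - l := measurable_const.sub measurable_id
  -- the reflected conjugate function
  set f' : ℝ → ℂ := fun l => conj (f (2 - l)) with hf'
  have hf'm : Measurable f' := Complex.continuous_conj.measurable.comp (hf.comp hrefl)
  have hf'C : ∀ l, ‖f' l‖ ≤ C := fun l => by
    simp only [hf', Complex.norm_conj]; exact hC _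
  -- approximants for `f` in `L¹(μ_x)`
  obtain ⟨g, hgc, hgb, hg⟩ :=
    exists_seq_continuous_tendsto_integral (specMeasure (modR K) hR x) hf hC
  have h1 := tendsto_cfcC_borelCFC hR hf hC x hgc hgb hg
  have h1J : Tendsto (fun n => modJ K hsep hdense (cfcC (modR K) (g n) x)) atTop
      (𝓝 (modJ K hsep hdense (borelCFC (modR K) hR f x))) :=
    ((modJ K hsep hdense).continuous.tendsto _).comp h1
  have heq : (fun n => modJ K hsep hdense (cfcC (modR K) (g n) x)) =
      fun n => cfcC (modR K) (fun l => conj (g n (2 - l))) (modJ K hsep hdense x) := by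
    ext n
    exact modJ_cfcC K hsep hdense (hgc n) x
  rw [heq] at h1J
  -- the reflected approximants approximate `f'` in `L¹(μ_{Jx}) = L¹((2 − ·)_* μ_x)`
  have hg' : Tendsto (fun n => ∫ l, ‖f' l - conj (g n (2 - l))‖
      ∂(specMeasure (modR K) hR (modJ K hsep hdense x))) atTop (𝓝 0) := by
    rw [specMeasure_modJ K hsep hdense x]
    refine hg.congr fun n => ?_
    have hmeas : AEStronglyMeasurable (fun l => ‖f' l - conj (g n (2 - l))‖)
        ((specMeasure (modR K) hR x).map (fun l : ℝ => 2 - l)) :=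
      (hf'm.sub (Complex.continuous_conj.measurable.comp ((hgc n).measurable.comp hrefl))).norm
        |>.aestronglyMeasurable
    rw [integral_map hrefl.aemeasurable hmeas]
    congr 1; ext l
    simp only [hf', sub_sub_cancel, ← map_sub, Complex.norm_conj]
  have h2 := tendsto_cfcC_borelCFC hR hf'm hf'C (modJ K hsep hdense x)
    (g := fun n l => conj (g n (2 - l)))
    (fun n => Complex.continuous_conj.comp ((hgc n).comp (by fun_prop)))
    (C' := 2 * C) (fun n l => by simp only [Complex.norm_conj]; exact hgb n _) hg'
  exact tendsto_nhds_unique h1J h2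

/-- **`J Δ^{it} = Δ^{it} J`** (Rieffel–van Daele Prop. 3.3). [cite: RieffelVandaele1977, Prop. 3.3] -/
theorem modJ_modU (t : ℝ) (x : H) :
    modJ K hsep hdense (modU K t x) = modU K t (modJ K hsep hdense x) := by
  rw [modU_def, modJ_borelCFC K hsep hdense (measurable_modPhase t) (norm_modPhase_le t)]
  congr 2
  ext l
  exact conj_modPhase_two_sub t l

include hsep hdense in
/-- **`Δ^{it}` commutes with `P − Q = J T`** (Rieffel–van Daele Prop. 3.3, proof: "`Δ^{it}`
commutes with `R` and `T`, and so with `TJ`"). [cite: RieffelVandaele1977, Prop. 3.3] -/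
theorem modU_modB (t : ℝ) (x : H) : modU K t (modB K x) = modB K (modU K t x) := by
  rw [← modJ_modT K hsep hdense, ← modJ_modU K hsep hdense, ← mul_apply_eq_comp,
    ← (modT_commute_modU K t).eq, mul_apply_eq_comp, modJ_modT]

include hsep hdense in
/-- **`Δ^{it}` commutes with `P`**, so `Δ^{it} 𝒦 ⊆ 𝒦` (Rieffel–van Daele Prop. 3.3).
[cite: RieffelVandaele1977, Prop. 3.3] -/
theorem modU_starProjection (t : ℝ) (x : H) :
    modU K t (K.starProjection x) = K.starProjection (modU K t x) := by
  -- `2 P = R + B`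
  have h2 : ∀ y : H, (2 : ℂ) • K.starProjection y = modR K y + modB K y := fun y => by
    rw [modR_apply, modB_apply, two_smul]; abel
  have h := congrArg (modU K t) (h2 x)
  rw [map_smul, map_add, ← mul_apply_eq_comp, ← (modR_commute_modU K t).eq, mul_apply_eq_comp,
    modU_modB K hsep hdense, ← h2] at h
  exact smul_right_injective H (two_ne_zero) h

include hsep hdense in
/-- **`Δ^{it}` commutes with `Q`**. [cite: RieffelVandaele1977, Prop. 3.3] -/
theorem modU_starProjection_mulI (t : ℝ) (x : H) :
    modU K t ((mulI K).starProjection x) = (mulI K).starProjection (modU K t x) := by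
  have h2 : ∀ y : H, (2 : ℂ) • (mulI K).starProjection y = modR K y - modB K y := fun y => by
    rw [modR_apply, modB_apply, two_smul]; abel
  have h := congrArg (modU K t) (h2 x)
  rw [map_smul, map_sub, ← mul_apply_eq_comp, ← (modR_commute_modU K t).eq, mul_apply_eq_comp,
    modU_modB K hsep hdense, ← h2] at h
  exact smul_right_injective H (two_ne_zero) h

include hsep hdense in
/-- **`Δ^{it} 𝒦 ⊆ 𝒦`** (Rieffel–van Daele Prop. 3.3). [cite: RieffelVandaele1977, Prop. 3.3] -/
theorem modU_apply_mem {x : H} (hx : x ∈ K) (t : ℝ) : modU K t x ∈ K := by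
  rw [← Submodule.starProjection_eq_self_iff] at hx ⊢
  rw [← modU_starProjection K hsep hdense, hx]

end JU

end Literature.Analysis.OperatorTheory
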